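import Summits.QuantumFields.GaugeBoot.ClassBLimitPoints
import Summits.QuantumFields.GaugeBoot.ClassBLimitLinkRP
import Summits.QuantumFields.GaugeBoot.ClassBLimitSiteRP
import HarnessLib

/-!
# The Class-B identification is equivalent to diagonal RP of torus limit points (gauge-boot, L3(α))

HONEST FRAMING (cell `pub-gaugeboot`, page 1 of every file): the venture produces certified bounds
on lattice expectations at stated coupling, gauge group, dimension and torus size; NOT a mass gap,
NOT a continuum limit, NOT a string tension; NOT Yang–Mills-summit-bearing (barriers
`FixedCouplingUltralocality`, `PerturbativeInvisibility`).

**Theorem (`thermodynamicLimitIsClassB_iff`).** For a compact second countable Hausdorff group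
`G`, a continuous representation `ρ`, `d ≥ 1` and `β ≥ 0`:
`ThermodynamicLimitIsClassB d ρ β ↔ TorusLimitPointsDiagonalRP d ρ β` — every infinite-volume limit
point of the torus Wilson states is (the measure of) a Class-B state (`ClassB.lean`) if and only
if every such limit point is reflection positive in the diagonal hyperplanes `x_i = x_j`. In other
words, of the axioms of the lattice bootstrap's "Class B" (Kazakov–Zheng's three RP families plus
invariances and the one-link Gibbs identity), ALL BUT THE DIAGONAL FAMILY are theorems for torus
limit points: translation/permutation/reflection invariance (`ClassBLimitSymmetry.lean`, tree),
the Haar-shift identity (`ClassBHaarShift.lean`), site and link RP (`ClassBLimitSiteRP.lean`,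
`ClassBLimitLinkRP.lean`: Osterwalder–Seiler RP on every torus + the `L²` closure argument of
`ClassBRPClosure.lean`), transported here from the axis `0` to every axis by the axis transpositions
(`IsReflectionPositiveFor.of_conj`). The diagonal family is REFUTED on every finite torus
(`not_diagonalReflectionPositive`) and PROVED for symmetric finite volumes
(`DiagRP.isReflectionPositiveFor_diag_ymSpecification`); whether it survives in torus limit points
(`TorusLimitPointsDiagonalRP`) remains OPEN — this file shows it is EXACTLY what the
identification hinges on. Nothing is claimed about it.

References: K. Osterwalder, E. Seiler, Ann. Phys. 110 (1978) 440; V. Kazakov, Z. Zheng,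
arXiv:2203.11360 §3.1, arXiv:2404.16925 §3.2; H.-O. Georgii, Gibbs Measures and Phase Transitions
(2011) Ch. 4.
-/

noncomputable section

open MeasureTheory
open scoped ComplexOrder ComplexConjugate
open Literature.Probability.LatticeModels (Site)
open Literature.MathematicalPhysics.QuantumLattice

namespace Summit.QuantumFields.GaugeBoot

variable {d N : ℕ} {G : Type*} [Group G] [TopologicalSpace G] [IsTopologicalGroup G]
  [CompactSpace G] [MeasurableSpace G] [BorelSpace G]
variable (ρ : G →* Matrix (Fin N) (Fin N) ℂ)

/-! ## Transport of reflection positivity under a symmetry -/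

section Transport

omit [Group G] [TopologicalSpace G] [IsTopologicalGroup G] [CompactSpace G] [BorelSpace G] in
/-- **RP is transported by an involutive symmetry of the state**: if `π` preserves `μ`,
`π ∘ π = id`, `Θ = π ∘ Θ₀ ∘ π`, observables of the half `S` pull back under `π` to observables of
the half `S₀`, and `μ` is RP for `(Θ₀, S₀)`, then `μ` is RP for `(Θ, S)`. -/
theorem IsReflectionPositiveFor.of_conj {μ : Measure (LGConfig d G)}
    {Θ₀ Θ π : LGConfig d G → LGConfig d G} {S₀ S : Set (ZdEdge d)} (hπ : MeasurePreserving π μ μ)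
    (hΘ₀ : Measurable Θ₀) (hππ : ∀ U, π (π U) = U) (hΘ : ∀ U, Θ U = π (Θ₀ (π U)))
    (hS : ∀ F : LGConfig d G → ℂ, DependsOn F S → DependsOn (F ∘ π) S₀)
    (h0 : IsReflectionPositiveFor Θ₀ S₀ μ) : IsReflectionPositiveFor Θ S μ := by
  intro F hF hFb hFS
  obtain ⟨C, hC⟩ := hFb
  have hG := h0 (F ∘ π) (hF.comp hπ.measurable) ⟨C, fun U => hC _⟩ (hS F hFS)
  have hm : Measurable fun V : LGConfig d G => conj ((F ∘ π) (Θ₀ V)) * (F ∘ π) V :=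
    (Complex.continuous_conj.measurable.comp ((hF.comp hπ.measurable).comp hΘ₀)).mul
      (hF.comp hπ.measurable)
  have key : ∫ U, conj (F (Θ U)) * F U ∂μ =
      ∫ U, (fun V : LGConfig d G => conj ((F ∘ π) (Θ₀ V)) * (F ∘ π) V) (π U) ∂μ :=
    integral_congr_ae (ae_of_all _ fun U => by simp only [Function.comp_apply, hΘ U, hππ])
  rw [key, ← integral_map hπ.measurable.aemeasurable hm.aestronglyMeasurable, hπ.map_eq]
  exact hG

variable [NeZero d]

omit [Group G] [TopologicalSpace G] [IsTopologicalGroup G] [CompactSpace G] [MeasurableSpace G]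
  [BorelSpace G] in
/-- A transposition of axes acts as an involution on configurations. -/
theorem configPerm_swap_configPerm_swap (i : Fin d) (U : LGConfig d G) :
    configPerm (Equiv.swap 0 i) (configPerm (Equiv.swap 0 i) U) = U := by
  funext e
  simp only [configPerm, Equiv.symm_swap, Equiv.swap_apply_self]
  congr 1
  ext1
  · funext m; simp [Equiv.swap_apply_self]
  · rfl

omit [TopologicalSpace G] [IsTopologicalGroup G] [CompactSpace G] [MeasurableSpace G] [BorelSpace G] in
/-- **A general link reflection is conjugate to the axis-`0` link reflection by `(0 i)`.** -/
theorem configLinkReflect_eq_conj (i : Fin d) (U : LGConfig d G) :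
    configLinkReflect i U =
      configPerm (Equiv.swap 0 i) (configLinkReflect 0 (configPerm (Equiv.swap 0 i) U)) := by
  set σ : Equiv.Perm (Fin d) := Equiv.swap 0 i with hσ
  funext e
  obtain ⟨x, k⟩ := e
  have key : ∀ c : ℤ, ((zdLinkReflect 0 (x ∘ ⇑σ) - Pi.single (0 : Fin d) c : Site d) ∘ ⇑σ) =
      (zdLinkReflect i x - Pi.single i c : Site d) := by
    intro c
    funext m
    simp only [hσ, Function.comp_apply, Pi.sub_apply, zdLinkReflect, Function.update_apply,
      Pi.single_apply, Equiv.swap_apply_eq_iff, Equiv.swap_apply_left, Equiv.swap_apply_self]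
  have k0 : (zdLinkReflect 0 (x ∘ ⇑σ) : Site d) ∘ ⇑σ = zdLinkReflect i x := by
    simpa using key 0
  simp only [configPerm, configLinkReflect_apply, hσ, Equiv.symm_swap, Equiv.swap_apply_self,
    Equiv.swap_apply_left, Equiv.swap_apply_eq_iff]
  by_cases hk : k = i
  · rw [if_pos hk, if_pos hk, ← hσ, key 1]
  · rw [if_neg hk, if_neg hk, ← hσ, k0]

omit [Group G] [TopologicalSpace G] [IsTopologicalGroup G] [CompactSpace G] [MeasurableSpace G]
  [BorelSpace G] in
/-- Observables of the site half `{x_i ≥ 0}` pull back under `(0 i)` to observables of `{x_0 ≥ 0}`. -/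
theorem dependsOn_comp_configPerm_siteHalf (i : Fin d) (F : LGConfig d G → ℂ)
    (hF : DependsOn F (siteHalfEdges i)) :
    DependsOn (F ∘ configPerm (Equiv.swap 0 i)) (siteHalfEdges 0) := by
  intro U V hUV
  simp only [Function.comp_apply]
  apply hF
  intro e he
  simp only [configPerm, Equiv.symm_swap]
  apply hUV
  show (0 : ℤ) ≤ (e.1 ∘ ⇑(Equiv.swap 0 i)) 0
  have he' : (0 : ℤ) ≤ e.1 i := he
  simpa [Equiv.swap_apply_left] using he' 

omit [Group G] [TopologicalSpace G] [IsTopologicalGroup G] [CompactSpace G] [MeasurableSpace G]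
  [BorelSpace G] in
/-- Observables of the link half `{x_i ≥ 1}` pull back under `(0 i)` to observables of `{x_0 ≥ 1}`. -/
theorem dependsOn_comp_configPerm_linkHalf (i : Fin d) (F : LGConfig d G → ℂ)
    (hF : DependsOn F (linkHalfEdges i)) :
    DependsOn (F ∘ configPerm (Equiv.swap 0 i)) (linkHalfEdges 0) := by
  intro U V hUV
  simp only [Function.comp_apply]
  apply hF
  intro e he
  simp only [configPerm, Equiv.symm_swap]
  apply hUV
  show (1 : ℤ) ≤ (e.1 ∘ ⇑(Equiv.swap 0 i)) 0
  have he' : (1 : ℤ) ≤ e.1 i := he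
  simpa [Equiv.swap_apply_left] using he' 

end Transport

/-! ## All axes; the identification theorem -/

section Identification

variable [NeZero d] [T2Space G] [SecondCountableTopology G]

/-- **Site RP of torus limit points in every axis hyperplane `x_i = 0`** (`β ≥ 0`). -/
theorem siteRP_of_mem_infiniteVolumeLimitPoints (hρ : Continuous ρ) {β : ℝ} (hβ : 0 ≤ β)
    {μ : Measure (LGConfig d G)} (hμ : μ ∈ infiniteVolumeLimitPoints (d := d) ρ β) (i : Fin d) :
    IsReflectionPositiveFor (configSiteReflect (G := G) i) (siteHalfEdges i) μ :=
  IsReflectionPositiveFor.of_conj (permInvariant_of_mem_infiniteVolumeLimitPoints ρ hρ hμ _)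
    (measurable_configSiteReflect 0) (configPerm_swap_configPerm_swap i) (configSiteReflect_eq_conj i)
    (dependsOn_comp_configPerm_siteHalf i) (siteRP_zero_of_mem_infiniteVolumeLimitPoints ρ hρ hβ hμ)

/-- **Link RP of torus limit points in every link hyperplane `x_i = ½`** (`β ≥ 0`). -/
theorem linkRP_of_mem_infiniteVolumeLimitPoints (hρ : Continuous ρ) {β : ℝ} (hβ : 0 ≤ β)
    {μ : Measure (LGConfig d G)} (hμ : μ ∈ infiniteVolumeLimitPoints (d := d) ρ β) (i : Fin d) :
    IsReflectionPositiveFor (configLinkReflect (G := G) i) (linkHalfEdges i) μ :=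
  IsReflectionPositiveFor.of_conj (permInvariant_of_mem_infiniteVolumeLimitPoints ρ hρ hμ _)
    (measurable_configLinkReflect 0) (configPerm_swap_configPerm_swap i) (configLinkReflect_eq_conj i)
    (dependsOn_comp_configPerm_linkHalf i) (linkRP_zero_of_mem_infiniteVolumeLimitPoints ρ hρ hβ hμ)

/-- **Diagonal RP of the limit points implies the Class-B identification** (`β ≥ 0`): if every
torus limit point is reflection positive in the diagonal hyperplanes, then every torus limit point
is a Class-B state — all other Class-B properties being theorems. -/
theorem thermodynamicLimitIsClassB_of_diagRP (hρ : Continuous ρ) {β : ℝ} (hβ : 0 ≤ β)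
    (hdiag : TorusLimitPointsDiagonalRP d ρ β) : ThermodynamicLimitIsClassB d ρ β := by
  intro μ hμ
  exact exists_classBState_of_reflectionPositive ρ hρ hμ
    (siteRP_of_mem_infiniteVolumeLimitPoints ρ hρ hβ hμ)
    (linkRP_of_mem_infiniteVolumeLimitPoints ρ hρ hβ hμ) (hdiag μ hμ)

/-- **The Class-B identification is equivalent to diagonal RP of torus limit points** (`β ≥ 0`):
`ThermodynamicLimitIsClassB d ρ β ↔ TorusLimitPointsDiagonalRP d ρ β`. The right-hand side is
OPEN (refuted on finite tori, proved for symmetric finite volumes); nothing is claimed about it. -/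
theorem thermodynamicLimitIsClassB_iff (hρ : Continuous ρ) {β : ℝ} (hβ : 0 ≤ β) :
    ThermodynamicLimitIsClassB d ρ β ↔ TorusLimitPointsDiagonalRP d ρ β :=
  ⟨torusLimitPointsDiagonalRP_of_thermodynamicLimitIsClassB ρ,
    thermodynamicLimitIsClassB_of_diagRP ρ hρ hβ⟩

end Identification

end Summit.QuantumFields.GaugeBoot
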